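import Mathlib
import Literature.Analysis.FluidPDE.ClassicalSolution
import Literature.Analysis.FluidPDE.LerayHopf
import Literature.Analysis.FluidPDE.SuitableWeak
import Literature.Analysis.FluidPDE.TaoLocalisation
import Summits.NavierStokesRegularity.NavierStokesRegularity.Theses.L3TimeExponentPincer
import Summits.NavierStokesRegularity.NavierStokesRegularity.Theorems.L3TimeExponentPincerEffNode
import Summits.NavierStokesRegularity.NavierStokesRegularity.Theorems.L3TimeExponentPincerSmoothBranch
import Summits.NavierStokesRegularity.NavierStokesRegularity.Theorems.L3TimeExponentPincerPaceDichotomy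
import Summits.NavierStokesRegularity.NavierStokesRegularity.Theorems.L3TimeExponentPincerEffSatBlowupTypeIRung
import HarnessLib.Audit
import HarnessLib

/-!
# The Type-I regime of line `pace` (child crux `EffSatBlowup`, route `L3TimeExponentPincer`): all three stubs are
# DECIDED there, and the line's slow slice re-derives the Type-I rung

Support file for `stmt-NavierStokesRegularity-19139` (cell ns-regularity-ideate, seat p4), joining the Type-I rung
`Theorems.L3TimeExponentPincerEffSatBlowupTypeIRung` (p4) to the vocabulary of the registered line `pace` of the child
crux (`Theorems.L3TimeExponentPincerPaceDichotomy`, seat p2 ROUND-8: stubs `stub_parabolicConcentration_blowup` =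
`ParabolicConcentrationB`, `stub_morreyTypeI_slow` = `MorreyTypeISlowB`, `stub_morreyTypeII_fastFat` = `FastTimesFatB`).

* `parabolicConcentration_of_typeI_blowup'` — a frame sup-Type-I blow-up has `ParabolicConcentration u T`
  (stub 1's conclusion; unconditional, from the tree's `typeIConcentration_proof`);
* `l3Slow_of_typeI` — a Leray–Hopf field that is sup-Type-I at `T` is `L3Slow` (`‖u(t)‖₃³ ≤ A/√(T-t)`: stub 2's
  conclusion under the POINTWISE rate, by `‖u‖₃³ ≤ ‖u‖_∞ ∫|u|²` and the energy inequality);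
* `effSatNear_of_typeI_blowup_via_pace` — CONSISTENCY: the line's slow slice `effSatNear_of_parabolic_of_slow` applied
  to the two facts above returns `EffSatNear u T`, i.e. the Type-I rung is the line's composition on its decided regime;
* `parabolicConcentrationB_of_typeI`, `morreyTypeISlowB_of_typeI`, `fastTimesFatB_of_typeI` and their `_of_noTypeII`
  forms — the three stub statements BY NAME under "every frame blow-up is Type I" = hard core `NoTypeII` (stmt-0056);
* `l3RateLaw_of_effSatBlowup` (refuter-facing) — the child crux CONTAINS the a-priori rate law
  `‖u(t)‖₃ ≤ K (T-t)^{-1/5}` for every frame blow-up (`l3Rate_of_effSaturatesAt` at `σ = 1`): one Leray–Hopf blow-up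
  whose critical norm grows faster refutes `EffSatBlowup`.

0 `sorry`.  WHAT THIS IS NOT: not a claim about Navier–Stokes regularity; no stub of line `pace` is closed here (each
is decided only on the Type-I regime); everything is an implication between typed tree predicates.
-/

noncomputable section

namespace Summit.NavierStokesRegularity.NavierStokesRegularity.Theorems.L3TimeExponentPincerPaceTypeIRungs

open MeasureTheory Set Filter Metric Function Topology
open scoped ENNReal NNReal Topology
open Literature.Analysis.FluidPDE
open Summit.NavierStokesRegularity.NavierStokesRegularity.Theorems.L3TimeExponentPincerEffNode
open Summit.NavierStokesRegularity.NavierStokesRegularity.Theorems.L3TimeExponentPincerSmoothBranch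
open Summit.NavierStokesRegularity.NavierStokesRegularity.Theorems.L3TimeExponentPincerPaceDichotomy
open Summit.NavierStokesRegularity.NavierStokesRegularity.Theorems.L3TimeExponentPincerEffSatTypeIRung

/-! ## §1  Stub 1 and stub 2 of line `pace` on the Type-I regime -/

/-- **Stub 1 on the Type-I regime.**  A classical solution on `[0,T)`, Leray–Hopf from a rapidly decaying datum,
sup-Type-I at `T` and with no smooth extension past `T` has `ParabolicConcentration u T` (energy `≥ γ√(T-t)` in a ball
of radius `c√(T-t)` about a fixed centre, on a final window). -/
theorem parabolicConcentration_of_typeI_blowup' {ν T : ℝ} (hν : 0 < ν) (hT : 0 < T)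
    {u : ℝ → (EuclideanSpace ℝ (Fin 3)) → (EuclideanSpace ℝ (Fin 3))} {p : ℝ → (EuclideanSpace ℝ (Fin 3)) → ℝ}
    (hcl : IsClassicalNSSolutionOn (Ico 0 T) ν 0 u p) (hLH : IsLerayHopfOn T ν 0 (u 0) u)
    (hdec : HasRapidSpatialDecay (u 0)) (hTI : IsTypeIBlowup u T)
    (hmax : ¬ HasSmoothExtensionPast ν 0 u T) : ParabolicConcentration u T := by
  obtain ⟨C, -, γ, hγ, c, hc, x₀, T₁, hT₁, hwin⟩ :=
    parabolicConcentration_of_typeI_blowup hν hT hcl hLH hdec hTI hmax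
  exact ⟨γ, hγ, c, hc, T₁, hT₁, fun t ht => ⟨x₀, (hwin t ht).2⟩⟩

/-- **Stub 2's conclusion under the POINTWISE Type-I rate.**  A Leray–Hopf field (`ν > 0`, `f = 0`) that is
sup-Type-I at `T` is `L3Slow`: `‖u(t)‖₃³ ≤ (|C|+1)(2E(u₀)+1)/√(T-t)` on a final window (`‖u‖₃³ ≤ ‖u‖_∞ ∫|u|²`). -/
theorem l3Slow_of_typeI {ν T : ℝ} (hν : 0 < ν) (hT : 0 < T)
    {u : ℝ → (EuclideanSpace ℝ (Fin 3)) → (EuclideanSpace ℝ (Fin 3))}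
    (hLH : IsLerayHopfOn T ν 0 (u 0) u) (hTI : IsTypeIBlowup u T) : L3Slow u T := by
  obtain ⟨C, hev⟩ := hTI
  obtain ⟨l, hlT, hl⟩ := (mem_nhdsLT_iff_exists_Ioo_subset).1 hev
  set C' : ℝ := |C| + 1 with hC'
  have hC'pos : 0 < C' := by positivity
  have hCC' : C ≤ C' := (le_abs_self C).trans (by linarith)
  set E2 : ℝ := 2 * VectorCalculus.kineticEnergy (u 0) with hE2
  have hE2nn : 0 ≤ E2 :=
    mul_nonneg zero_le_two (Literature.Analysis.FluidPDE.kineticEnergy_nonneg _)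
  refine ⟨C' * (E2 + 1), by positivity, max l 0, max_lt hlT hT, fun t ht => ?_⟩
  have htl : t ∈ Ioo l T := ⟨lt_of_le_of_lt (le_max_left _ _) ht.1, ht.2⟩
  have ht0 : t ∈ Icc 0 T := ⟨(le_max_right l 0).trans ht.1.le, ht.2.le⟩
  have hs : 0 < Real.sqrt (T - t) := Real.sqrt_pos.2 (sub_pos.2 ht.2)
  have hpt : ∀ x, ‖u t x‖ ≤ C' / Real.sqrt (T - t) := fun x =>
    (hl htl x).trans (div_le_div_of_nonneg_right hCC' hs.le)
  have hEt : ∫⁻ x, ‖u t x‖ₑ ^ 2 ≤ ENNReal.ofReal E2 := hLH.lintegral_enorm_sq_le hν.le ht0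
  have hU : 0 ≤ C' / Real.sqrt (T - t) := by positivity
  have hrew : C' * (E2 + 1) / Real.sqrt (T - t) = C' / Real.sqrt (T - t) * (E2 + 1) := by ring
  calc eLpNorm (u t) 3 volume ^ (3 : ℝ)
      ≤ ENNReal.ofReal (C' / Real.sqrt (T - t)) * ∫⁻ x, ‖u t x‖ₑ ^ 2 :=
        eLpNorm_three_rpow_three_le_of_forall_le hpt
    _ ≤ ENNReal.ofReal (C' / Real.sqrt (T - t)) * ENNReal.ofReal E2 := by gcongr
    _ = ENNReal.ofReal (C' / Real.sqrt (T - t) * E2) := (ENNReal.ofReal_mul hU).symm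
    _ ≤ ENNReal.ofReal (C' * (E2 + 1) / Real.sqrt (T - t)) := by
        refine ENNReal.ofReal_le_ofReal ?_
        rw [hrew]
        gcongr
        linarith

/-- **CONSISTENCY of line `pace` on its decided regime.**  For a frame Type-I blow-up the line's slow slice
(`effSatNear_of_parabolic_of_slow`: parabolic concentration + `L³`-slow ⇒ `K₃(1)` near `T`) applied to §1 returns
`EffSatNear u T` — the Type-I rung of `Theorems.L3TimeExponentPincerEffSatBlowupTypeIRung` factored through the line. -/
theorem effSatNear_of_typeI_blowup_via_pace {ν T : ℝ} (hν : 0 < ν) (hT : 0 < T)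
    {u : ℝ → (EuclideanSpace ℝ (Fin 3)) → (EuclideanSpace ℝ (Fin 3))} {p : ℝ → (EuclideanSpace ℝ (Fin 3)) → ℝ}
    (hcl : IsClassicalNSSolutionOn (Ico 0 T) ν 0 u p) (hLH : IsLerayHopfOn T ν 0 (u 0) u)
    (hdec : HasRapidSpatialDecay (u 0)) (hTI : IsTypeIBlowup u T)
    (hmax : ¬ HasSmoothExtensionPast ν 0 u T) : EffSatNear u T :=
  effSatNear_of_parabolic_of_slow (parabolicConcentration_of_typeI_blowup' hν hT hcl hLH hdec hTI hmax)
    (l3Slow_of_typeI hν hT hLH hTI)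

/-! ## §2  The three stub statements of line `pace` BY NAME under "every frame blow-up is Type I" (`NoTypeII`) -/

/-- Stub 1 `ParabolicConcentrationB` under "every frame blow-up is Type I". -/
theorem parabolicConcentrationB_of_typeI
    (hTI : ∀ (ν T : ℝ), 0 < ν → 0 < T →
      ∀ (u : ℝ → (EuclideanSpace ℝ (Fin 3)) → (EuclideanSpace ℝ (Fin 3))) (p : ℝ → (EuclideanSpace ℝ (Fin 3)) → ℝ),
      IsClassicalNSSolutionOn (Ico 0 T) ν 0 u p → IsLerayHopfOn T ν 0 (u 0) u →
      HasRapidSpatialDecay (u 0) → ¬ HasSmoothExtensionPast ν 0 u T → IsTypeIBlowup u T) :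
    ParabolicConcentrationB :=
  fun ν T hν hT u p hcl hLH hdec hmax =>
    parabolicConcentration_of_typeI_blowup' hν hT hcl hLH hdec (hTI ν T hν hT u p hcl hLH hdec hmax) hmax

/-- Stub 2 `MorreyTypeISlowB` under "every frame blow-up is Type I" (the Morrey hypothesis is not even used). -/
theorem morreyTypeISlowB_of_typeI
    (hTI : ∀ (ν T : ℝ), 0 < ν → 0 < T →
      ∀ (u : ℝ → (EuclideanSpace ℝ (Fin 3)) → (EuclideanSpace ℝ (Fin 3))) (p : ℝ → (EuclideanSpace ℝ (Fin 3)) → ℝ),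
      IsClassicalNSSolutionOn (Ico 0 T) ν 0 u p → IsLerayHopfOn T ν 0 (u 0) u →
      HasRapidSpatialDecay (u 0) → ¬ HasSmoothExtensionPast ν 0 u T → IsTypeIBlowup u T) :
    MorreyTypeISlowB :=
  fun ν T hν hT u p hcl hLH hdec hmax _ => l3Slow_of_typeI hν hT hLH (hTI ν T hν hT u p hcl hLH hdec hmax)

/-- Stub 3 `FastTimesFatB` under "every frame blow-up is Type I" (through the crux itself: `effSatBlowup_of_typeI`
and `fastTimesFatB_of_effSatBlowup`). -/
theorem fastTimesFatB_of_typeI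
    (hTI : ∀ (ν T : ℝ), 0 < ν → 0 < T →
      ∀ (u : ℝ → (EuclideanSpace ℝ (Fin 3)) → (EuclideanSpace ℝ (Fin 3))) (p : ℝ → (EuclideanSpace ℝ (Fin 3)) → ℝ),
      IsClassicalNSSolutionOn (Ico 0 T) ν 0 u p → IsLerayHopfOn T ν 0 (u 0) u →
      HasRapidSpatialDecay (u 0) → ¬ HasSmoothExtensionPast ν 0 u T → IsTypeIBlowup u T) :
    FastTimesFatB :=
  fastTimesFatB_of_effSatBlowup (effSatBlowup_of_typeI hTI)

/-- Stub 1 of line `pace` is implied by the hard core `NoTypeII` (stmt-NavierStokesRegularity-0056). -/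
theorem parabolicConcentrationB_of_noTypeII
    (h : Summit.NavierStokesRegularity.NavierStokesRegularity.Theses.TypeICertificateLadder.NoTypeII) :
    ParabolicConcentrationB :=
  parabolicConcentrationB_of_typeI fun ν T hν hT u p hcl hLH hdec hmax => h ν T hν hT u p ⟨hcl, hmax⟩ hLH hdec

/-- Stub 2 of line `pace` is implied by the hard core `NoTypeII` (stmt-NavierStokesRegularity-0056). -/
theorem morreyTypeISlowB_of_noTypeII
    (h : Summit.NavierStokesRegularity.NavierStokesRegularity.Theses.TypeICertificateLadder.NoTypeII) :
    MorreyTypeISlowB :=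
  morreyTypeISlowB_of_typeI fun ν T hν hT u p hcl hLH hdec hmax => h ν T hν hT u p ⟨hcl, hmax⟩ hLH hdec

/-- Stub 3 of line `pace` is implied by the hard core `NoTypeII` (stmt-NavierStokesRegularity-0056). -/
theorem fastTimesFatB_of_noTypeII
    (h : Summit.NavierStokesRegularity.NavierStokesRegularity.Theses.TypeICertificateLadder.NoTypeII) :
    FastTimesFatB :=
  fastTimesFatB_of_typeI fun ν T hν hT u p hcl hLH hdec hmax => h ν T hν hT u p ⟨hcl, hmax⟩ hLH hdec

/-! ## §3  What the child crux COSTS: the a-priori `L³` rate law it contains (refuter-facing) -/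

/-- **`EffSatBlowup` ⇒ the Euler-pace `L³` RATE LAW on the blow-up branch.**  If the route item
`…Theses.L3TimeExponentPincer.EffSatBlowup` holds then every frame solution with no smooth extension past `T` obeys
`‖u(t)‖₃ ≤ K (T-t)^{-1/5}` on a final window (`l3Rate_of_effSaturatesAt` at `σ = 1`).  This is the a-priori estimate any
proof of the child crux must deliver, and the cheapest kill: ONE Leray–Hopf blow-up whose critical norm grows faster
than `(T-t)^{-1/5}` refutes `EffSatBlowup` (and, for growth beyond `(T-t)^{-1/q}` with `q < 5`, the parent too). -/
theorem l3RateLaw_of_effSatBlowup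
    (h : Summit.NavierStokesRegularity.NavierStokesRegularity.Theses.L3TimeExponentPincer.EffSatBlowup)
    {ν T : ℝ} (hν : 0 < ν) (hT : 0 < T)
    {u : ℝ → (EuclideanSpace ℝ (Fin 3)) → (EuclideanSpace ℝ (Fin 3))} {p : ℝ → (EuclideanSpace ℝ (Fin 3)) → ℝ}
    (hcl : IsClassicalNSSolutionOn (Ico 0 T) ν 0 u p) (hLH : IsLerayHopfOn T ν 0 (u 0) u)
    (hdec : HasRapidSpatialDecay (u 0)) (hmax : ¬ HasSmoothExtensionPast ν 0 u T) :
    ∃ K : ℝ, 0 ≤ K ∧ ∃ T₁ : ℝ, 0 ≤ T₁ ∧ T₁ < T ∧ ∀ t ∈ Ioo T₁ T,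
      eLpNorm (u t) 3 volume ≤ ENNReal.ofReal (K * (T - t) ^ (-(1 / 5 : ℝ))) := by
  have hK : EffSaturatesAt 1 u T := (effScaleSaturationB_one_iff_stub.2 h) ν T hν hT u p hcl hLH hdec hmax
  have h15 : -((1 : ℝ) / (6 * 1 - 1)) = -(1 / 5 : ℝ) := by norm_num
  obtain ⟨K, hK0, T₁, hT₁0, hT₁T, hrate⟩ := l3Rate_of_effSaturatesAt (σ := 1) (by norm_num) hν hT hLH hK
  exact ⟨K, hK0, T₁, hT₁0, hT₁T, fun t ht => by simpa only [h15] using hrate t ht⟩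

end Summit.NavierStokesRegularity.NavierStokesRegularity.Theorems.L3TimeExponentPincerPaceTypeIRungs

end
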